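import Summits.Ventures.LatticeQCDFlow.Exactness.FlowSamplerSymmetrisationDirichlet
import HarnessLib

/-!
# SYMMETRISING A FLOW CAN SLOW A MIXED-PARITY OBSERVABLE: an exact three-state witness on which both samplers act diagonally

HONEST FRAMING: exact (Metropolis-corrected) sampling algorithms for lattice gauge theory;
figures of merit are autocorrelation/cost numbers at stated couplings and volumes; no
continuum-physics claim.  (SCALAR calibration rung S0-A: not a gauge result.)

Venture `LatticeQCDFlow` (cell pub-lqcd), topic `Exactness`; FANOUT row 2 (`s0-phi4`, FLOW arm
`imhOp μ w q̃` and its `Z₂`-symmetrisation `imhOp μ w q̃ₛ`, `q̃ₛ = ½(q̃ + q̃ ∘ σ)`).  NEW WORK of the cell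
(a NEGATIVE result closing the 'NOT CLAIMED: observables of mixed parity' line of
`FlowSamplerSymmetrisationDirichlet` / `Phi4FlowSymmetrisedParity`): the comparison
`τ_int^{q̃ₛ}(g) ≤ τ_int^{q̃}(g)`, proved in the tree for every EVEN or ODD square-integrable `g`, is
FALSE for general `g`.  The witness lives in the same vocabulary (`imhOp`, `tauInt`) on the smallest
possible space: `X = Fin 3` with counting measure, the UNIFORM target `w ≡ 1`, the involution
`σ = (0 2)` (measure preserving, `w ∘ σ = w`), the flow `q̃ = (1/20, 3/5, 7/20)` — so
`q̃ₛ = (1/5, 3/5, 1/5) ≠ q̃` — and the centred mixed-parity observable `g = (0, −1, 1)`.  What makes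
it exact: BOTH samplers act DIAGONALLY on `g` — `K_q̃ g = ¼ g` and `K_{q̃ₛ} g = ⅖ g` — so every
autocorrelation is a geometric sequence in closed form, `ρ_q̃(k) = 4^{−k} < ρ_{q̃ₛ}(k) = (2/5)^k` at
EVERY lag `k ≥ 1`, both series are summable, and `τ_int^{q̃}(g) = 5/6 < 7/6 = τ_int^{q̃ₛ}(g)` (a 40 %
increase).  Equivalently the Dirichlet form DROPS: `𝓔_{q̃ₛ}(g) = 6/5 < 3/2 = 𝓔_q̃(g)`, so the
symmetrised sampler does not Peskun–Tierney-dominate the flow sampler on all of `L²(w)`; by the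
parity theorems of the tree the defect is carried entirely by the cross-parity terms.  Found by an
exact rational search (hub-local, seconds); verified here by `norm_num`.  Nothing is cited.

## What is proved (namespace `MixedParityWitness`; `μ = Measure.count` on `Fin 3`)

* the data are written as explicit vectors inside every statement (`![1/20, 3/5, 7/20]`,
  `![0, -1, 1]`, `Equiv.swap 0 2`, `fun _ => 1`; no definitions);
* `imhOp_qW_smul_gW` — `K_q̃ (c·g) = (c/4)·g`; `imhOp_qWs_smul_gW` — `K_{q̃ₛ} (c·g) = (2c/5)·g`;
* `autocorr_qW`, `autocorr_qWs` — `ρ_q̃(k) = (1/4)^k`, `ρ_{q̃ₛ}(k) = (2/5)^k`;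
* **`tauInt_qW`, `tauInt_qWs`** — `τ_int^{q̃}(g) = 5/6`, `τ_int^{q̃ₛ}(g) = 7/6`, both series summable;
* **`symmetrised_tauInt_not_le_offSector`** — THE WITNESS packaged against the hypothesis list of
  `symmetrised_tauInt_le_of_parity` (all of them hold except parity-homogeneity of `g`), with the
  conclusion reversed strictly; `symmetrised_autocorr_gt_offSector` — strict reversal at every lag;
  `symmetrised_dirichlet_lt_offSector` — the Dirichlet ordering fails.

NOT CLAIMED: that symmetrisation typically hurts mixed observables (it cures mode collapse —
`FlowSamplerSymmetrisationModeCollapse`); anything about the lattice (the phenomenon needs a flow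
that is far from symmetric AND an observable correlating the two parities); any trained network.
-/

namespace Summit.Ventures.LatticeQCDFlow.Exactness

namespace MixedParityWitness

open Real MeasureTheory Filter Finset Set Topology
open Summit.Ventures.LatticeQCDFlow.Scoring

/-! ## §1 The two samplers act diagonally on `g` -/

/-- **`K_q̃ (c·g) = (c/4)·g`**: the flow sampler with `q̃ = (1/20, 3/5, 7/20)` against the uniform target
on three points maps every multiple of `g = (0, −1, 1)` to a quarter of it. -/
theorem imhOp_qW_smul_gW (c : ℝ) :
    imhOp (Measure.count : Measure (Fin 3)) (fun _ => (1 : ℝ)) (![1 / 20, 3 / 5, 7 / 20])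
        (fun t => c * (![0, -1, 1] : Fin 3 → ℝ) t)
      = fun t => c / 4 * (![0, -1, 1] : Fin 3 → ℝ) t := by
  funext t
  unfold imhOp imhAcceptQ
  rw [integral_count]
  fin_cases t <;> simp [Fin.sum_univ_three] <;> norm_num [min_def] <;> ring

/-- **`K_{q̃ₛ} (c·g) = (2c/5)·g`** for the symmetrised flow `q̃ₛ = ½(q̃ + q̃ ∘ σ) = (1/5, 3/5, 1/5)`,
`σ = (0 2)`. -/
theorem imhOp_qWs_smul_gW (c : ℝ) :
    imhOp (Measure.count : Measure (Fin 3)) (fun _ => (1 : ℝ))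
        (fun s => ((![1 / 20, 3 / 5, 7 / 20] : Fin 3 → ℝ) s
          + (![1 / 20, 3 / 5, 7 / 20] : Fin 3 → ℝ) (Equiv.swap (0 : Fin 3) 2 s)) / 2)
        (fun t => c * (![0, -1, 1] : Fin 3 → ℝ) t)
      = fun t => 2 * c / 5 * (![0, -1, 1] : Fin 3 → ℝ) t := by
  funext t
  unfold imhOp imhAcceptQ
  rw [integral_count]
  fin_cases t <;> simp [Fin.sum_univ_three, Equiv.swap_apply_def] <;> norm_num [min_def] <;> ring

/-! ## §2 Iterates, autocorrelations, `τ_int` in closed form -/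

/-- `K_q̃^n (c·g) = c·4^{−n}·g`. -/
theorem iterate_qW_smul (n : ℕ) (c : ℝ) :
    (imhOp (Measure.count : Measure (Fin 3)) (fun _ => (1 : ℝ)) (![1 / 20, 3 / 5, 7 / 20]))^[n]
        (fun t => c * (![0, -1, 1] : Fin 3 → ℝ) t)
      = fun t => c * (1 / 4) ^ n * (![0, -1, 1] : Fin 3 → ℝ) t := by
  induction n generalizing c with
  | zero => funext t; simp
  | succ n ih =>
    rw [Function.iterate_succ_apply, imhOp_qW_smul_gW, ih]
    funext t
    ring

/-- `K_{q̃ₛ}^n (c·g) = c·(2/5)^n·g`. -/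
theorem iterate_qWs_smul (n : ℕ) (c : ℝ) :
    (imhOp (Measure.count : Measure (Fin 3)) (fun _ => (1 : ℝ))
        (fun s => ((![1 / 20, 3 / 5, 7 / 20] : Fin 3 → ℝ) s
          + (![1 / 20, 3 / 5, 7 / 20] : Fin 3 → ℝ) (Equiv.swap (0 : Fin 3) 2 s)) / 2))^[n]
        (fun t => c * (![0, -1, 1] : Fin 3 → ℝ) t)
      = fun t => c * (2 / 5) ^ n * (![0, -1, 1] : Fin 3 → ℝ) t := by
  induction n generalizing c with
  | zero => funext t; simp
  | succ n ih =>
    rw [Function.iterate_succ_apply, imhOp_qWs_smul_gW, ih]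
    funext t
    ring

/-- `g = 1·g` (bookkeeping for the iterate lemmas). -/
theorem gW_eq_one_smul : (![0, -1, 1] : Fin 3 → ℝ) = fun t => 1 * (![0, -1, 1] : Fin 3 → ℝ) t := by
  funext t; rw [one_mul]

/-- `∫ g² w = 2` (`w ≡ 1`, counting measure). -/
theorem sqNorm_gW : ∫ t, (![0, -1, 1] : Fin 3 → ℝ) t ^ 2 * (fun _ : Fin 3 => (1 : ℝ)) t
    ∂(Measure.count : Measure (Fin 3)) = 2 := by
  rw [integral_count]
  simp [Fin.sum_univ_three]
  norm_num

/-- **`ρ_q̃(k) = 4^{−k}`**: the normalised autocorrelation of `g` under the flow sampler. -/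
theorem autocorr_qW (k : ℕ) :
    (∫ x, (![0, -1, 1] : Fin 3 → ℝ) x
        * ((imhOp (Measure.count : Measure (Fin 3)) (fun _ => (1 : ℝ)) (![1 / 20, 3 / 5, 7 / 20]))^[k]
            (![0, -1, 1] : Fin 3 → ℝ)) x * (fun _ : Fin 3 => (1 : ℝ)) x ∂Measure.count)
      / ∫ x, (![0, -1, 1] : Fin 3 → ℝ) x ^ 2 * (fun _ : Fin 3 => (1 : ℝ)) x ∂Measure.count
      = (1 / 4) ^ k := by
  rw [sqNorm_gW]
  conv_lhs => rw [gW_eq_one_smul, iterate_qW_smul k 1]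
  rw [integral_count]
  simp [Fin.sum_univ_three]

/-- **`ρ_{q̃ₛ}(k) = (2/5)^k`**: the normalised autocorrelation of `g` under the SYMMETRISED sampler. -/
theorem autocorr_qWs (k : ℕ) :
    (∫ x, (![0, -1, 1] : Fin 3 → ℝ) x
        * ((imhOp (Measure.count : Measure (Fin 3)) (fun _ => (1 : ℝ))
            (fun s => ((![1 / 20, 3 / 5, 7 / 20] : Fin 3 → ℝ) s
              + (![1 / 20, 3 / 5, 7 / 20] : Fin 3 → ℝ) (Equiv.swap (0 : Fin 3) 2 s)) / 2))^[k]
            (![0, -1, 1] : Fin 3 → ℝ)) x * (fun _ : Fin 3 => (1 : ℝ)) x ∂Measure.count)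
      / ∫ x, (![0, -1, 1] : Fin 3 → ℝ) x ^ 2 * (fun _ : Fin 3 => (1 : ℝ)) x ∂Measure.count
      = (2 / 5) ^ k := by
  rw [sqNorm_gW]
  conv_lhs => rw [gW_eq_one_smul, iterate_qWs_smul k 1]
  rw [integral_count]
  simp [Fin.sum_univ_three]

/-- **`τ_int^{q̃}(g) = 5/6`**, the series being summable (`½ + Σ_{k≥1} 4^{−k} = ½ + ⅓`). -/
theorem tauInt_qW :
    (Summable fun n => (∫ x, (![0, -1, 1] : Fin 3 → ℝ) x
        * ((imhOp (Measure.count : Measure (Fin 3)) (fun _ => (1 : ℝ)) (![1 / 20, 3 / 5, 7 / 20]))^[n + 1]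
            (![0, -1, 1] : Fin 3 → ℝ)) x * (fun _ : Fin 3 => (1 : ℝ)) x ∂Measure.count)
      / ∫ x, (![0, -1, 1] : Fin 3 → ℝ) x ^ 2 * (fun _ : Fin 3 => (1 : ℝ)) x ∂Measure.count) ∧
    tauInt (fun n => (∫ x, (![0, -1, 1] : Fin 3 → ℝ) x
        * ((imhOp (Measure.count : Measure (Fin 3)) (fun _ => (1 : ℝ)) (![1 / 20, 3 / 5, 7 / 20]))^[n]
            (![0, -1, 1] : Fin 3 → ℝ)) x * (fun _ : Fin 3 => (1 : ℝ)) x ∂Measure.count)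
      / ∫ x, (![0, -1, 1] : Fin 3 → ℝ) x ^ 2 * (fun _ : Fin 3 => (1 : ℝ)) x ∂Measure.count) = 5 / 6 := by
  have h := hasSum_geometric_succ (r := (1 / 4 : ℝ)) (by rw [abs_of_pos (by norm_num)]; norm_num)
  simp only [autocorr_qW]
  refine ⟨h.summable, ?_⟩
  unfold tauInt
  rw [h.tsum_eq]
  norm_num

/-- **`τ_int^{q̃ₛ}(g) = 7/6`**, the series being summable (`½ + Σ_{k≥1} (2/5)^k = ½ + ⅔`). -/
theorem tauInt_qWs :
    (Summable fun n => (∫ x, (![0, -1, 1] : Fin 3 → ℝ) x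
        * ((imhOp (Measure.count : Measure (Fin 3)) (fun _ => (1 : ℝ))
            (fun s => ((![1 / 20, 3 / 5, 7 / 20] : Fin 3 → ℝ) s
              + (![1 / 20, 3 / 5, 7 / 20] : Fin 3 → ℝ) (Equiv.swap (0 : Fin 3) 2 s)) / 2))^[n + 1]
            (![0, -1, 1] : Fin 3 → ℝ)) x * (fun _ : Fin 3 => (1 : ℝ)) x ∂Measure.count)
      / ∫ x, (![0, -1, 1] : Fin 3 → ℝ) x ^ 2 * (fun _ : Fin 3 => (1 : ℝ)) x ∂Measure.count) ∧
    tauInt (fun n => (∫ x, (![0, -1, 1] : Fin 3 → ℝ) x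
        * ((imhOp (Measure.count : Measure (Fin 3)) (fun _ => (1 : ℝ))
            (fun s => ((![1 / 20, 3 / 5, 7 / 20] : Fin 3 → ℝ) s
              + (![1 / 20, 3 / 5, 7 / 20] : Fin 3 → ℝ) (Equiv.swap (0 : Fin 3) 2 s)) / 2))^[n]
            (![0, -1, 1] : Fin 3 → ℝ)) x * (fun _ : Fin 3 => (1 : ℝ)) x ∂Measure.count)
      / ∫ x, (![0, -1, 1] : Fin 3 → ℝ) x ^ 2 * (fun _ : Fin 3 => (1 : ℝ)) x ∂Measure.count) = 7 / 6 := by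
  have h := hasSum_geometric_succ (r := (2 / 5 : ℝ)) (by rw [abs_of_pos (by norm_num)]; norm_num)
  simp only [autocorr_qWs]
  refine ⟨h.summable, ?_⟩
  unfold tauInt
  rw [h.tsum_eq]
  norm_num

/-! ## §3 The hypotheses of the parity theorem, all but parity -/

/-- `σ = (0 2)` preserves counting measure on `Fin 3`. -/
theorem measurePreserving_swapW :
    MeasurePreserving (Equiv.swap (0 : Fin 3) 2) (Measure.count : Measure (Fin 3)) Measure.count := by
  refine ⟨measurable_of_countable _, Measure.ext_of_singleton fun a => ?_⟩
  rw [Measure.map_apply (measurable_of_countable _) (MeasurableSet.singleton a)]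
  have e : (Equiv.swap (0 : Fin 3) 2) ⁻¹' {a} = {Equiv.swap (0 : Fin 3) 2 a} := by
    ext x
    simp only [Set.mem_preimage, Set.mem_singleton_iff, Equiv.swap_apply_eq_iff]
  rw [e, Measure.count_singleton, Measure.count_singleton]

/-- `g` is NOT parity-homogeneous: `g ∘ σ ≠ c·g` for every `c` (it mixes the even and odd sectors). -/
theorem gW_not_homogeneous (c : ℝ) :
    ¬ ∀ x, (![0, -1, 1] : Fin 3 → ℝ) (Equiv.swap (0 : Fin 3) 2 x) = c * (![0, -1, 1] : Fin 3 → ℝ) x := by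
  intro h
  have h0 := h 0
  simp at h0

/-! ## §4 The packaged witness -/

/-- **SYMMETRISING A FLOW CAN INCREASE `τ_int` OF A MIXED-PARITY OBSERVABLE.**  There are a
measure-preserving involution `σ` of a (three-point, counting) measure space, an invariant positive
integrable target weight `w` (`w ∘ σ = w`), a positive normalised model density `q̃` and a centred
square-integrable observable `g` with `∫ g² w > 0` — every hypothesis of
`symmetrised_tauInt_le_of_parity` except `g ∘ σ = ±g` — such that BOTH autocorrelation series are
summable and `τ_int^{q̃}(g) < τ_int^{q̃ₛ}(g)` STRICTLY (`5/6 < 7/6`), `q̃ₛ = ½(q̃ + q̃ ∘ σ)`. -/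
theorem symmetrised_tauInt_not_le_offSector :
    ∃ (σ : Fin 3 → Fin 3) (w q g : Fin 3 → ℝ),
      MeasurePreserving σ (Measure.count : Measure (Fin 3)) Measure.count ∧ (∀ x, σ (σ x) = x) ∧
      (∀ t, 0 < w t) ∧ Measurable w ∧ Integrable w (Measure.count : Measure (Fin 3)) ∧
      (∀ t, w (σ t) = w t) ∧
      (∀ t, 0 < q t) ∧ Measurable q ∧ Integrable q (Measure.count : Measure (Fin 3)) ∧
      (∫ z, q z ∂(Measure.count : Measure (Fin 3)) = 1) ∧
      Measurable g ∧ Integrable (fun t => g t ^ 2 * w t) (Measure.count : Measure (Fin 3)) ∧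
      (0 < ∫ t, g t ^ 2 * w t ∂(Measure.count : Measure (Fin 3))) ∧
      (∫ t, g t * w t ∂(Measure.count : Measure (Fin 3)) = 0) ∧
      (¬ ∃ c : ℝ, ∀ x, g (σ x) = c * g x) ∧
      (Summable fun n => (∫ x, g x * ((imhOp Measure.count w q)^[n + 1] g) x * w x ∂Measure.count)
        / ∫ x, g x ^ 2 * w x ∂Measure.count) ∧
      (Summable fun n => (∫ x, g x * ((imhOp Measure.count w (fun s => (q s + q (σ s)) / 2))^[n + 1] g) x
        * w x ∂Measure.count) / ∫ x, g x ^ 2 * w x ∂Measure.count) ∧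
      tauInt (fun n => (∫ x, g x * ((imhOp Measure.count w q)^[n] g) x * w x ∂Measure.count)
          / ∫ x, g x ^ 2 * w x ∂Measure.count)
        < tauInt (fun n => (∫ x, g x * ((imhOp Measure.count w (fun s => (q s + q (σ s)) / 2))^[n] g) x
          * w x ∂Measure.count) / ∫ x, g x ^ 2 * w x ∂Measure.count) := by
  refine ⟨Equiv.swap (0 : Fin 3) 2, fun _ => 1, ![1 / 20, 3 / 5, 7 / 20], ![0, -1, 1],
    measurePreserving_swapW, fun x => Equiv.swap_apply_self _ _ _, fun _ => one_pos, measurable_const,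
    Integrable.of_finite, fun _ => rfl, fun t => ?_, measurable_of_countable _, Integrable.of_finite,
    ?_, measurable_of_countable _, Integrable.of_finite, ?_, ?_, ?_, tauInt_qW.1, tauInt_qWs.1, ?_⟩
  · fin_cases t <;> simp
  · rw [integral_count]; simp [Fin.sum_univ_three]; norm_num
  · rw [sqNorm_gW]; norm_num
  · rw [integral_count]; simp [Fin.sum_univ_three]
  · rintro ⟨c, hc⟩; exact gW_not_homogeneous c hc
  · rw [tauInt_qW.2, tauInt_qWs.2]; norm_num

/-- **AT EVERY LAG `k ≥ 1` THE SYMMETRISED AUTOCORRELATION IS STRICTLY LARGER**: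
`ρ_q̃(k) = 4^{−k} < (2/5)^k = ρ_{q̃ₛ}(k)`. -/
theorem symmetrised_autocorr_gt_offSector (k : ℕ) (hk : 1 ≤ k) :
    (∫ x, (![0, -1, 1] : Fin 3 → ℝ) x
        * ((imhOp (Measure.count : Measure (Fin 3)) (fun _ => (1 : ℝ)) (![1 / 20, 3 / 5, 7 / 20]))^[k]
            (![0, -1, 1] : Fin 3 → ℝ)) x * (fun _ : Fin 3 => (1 : ℝ)) x ∂Measure.count)
      / ∫ x, (![0, -1, 1] : Fin 3 → ℝ) x ^ 2 * (fun _ : Fin 3 => (1 : ℝ)) x ∂Measure.count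
    < (∫ x, (![0, -1, 1] : Fin 3 → ℝ) x
        * ((imhOp (Measure.count : Measure (Fin 3)) (fun _ => (1 : ℝ))
            (fun s => ((![1 / 20, 3 / 5, 7 / 20] : Fin 3 → ℝ) s
              + (![1 / 20, 3 / 5, 7 / 20] : Fin 3 → ℝ) (Equiv.swap (0 : Fin 3) 2 s)) / 2))^[k]
            (![0, -1, 1] : Fin 3 → ℝ)) x * (fun _ : Fin 3 => (1 : ℝ)) x ∂Measure.count)
      / ∫ x, (![0, -1, 1] : Fin 3 → ℝ) x ^ 2 * (fun _ : Fin 3 => (1 : ℝ)) x ∂Measure.count := by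
  rw [autocorr_qW, autocorr_qWs]
  exact pow_lt_pow_left₀ (by norm_num) (by norm_num) (by omega)

/-- **THE DIRICHLET ORDERING FAILS OFF THE PARITY SECTORS**: `𝓔_{q̃ₛ}(g) = 6/5 < 3/2 = 𝓔_q̃(g)`
(`𝓔(v) = ∫ v² w − ∫ v (K v) w`), so `K_{q̃ₛ}` does not dominate `K_q̃` in Dirichlet form on `L²(w)`. -/
theorem symmetrised_dirichlet_lt_offSector :
    (∫ t, (![0, -1, 1] : Fin 3 → ℝ) t ^ 2 * (fun _ : Fin 3 => (1 : ℝ)) t ∂(Measure.count : Measure (Fin 3)))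
        - ∫ t, (![0, -1, 1] : Fin 3 → ℝ) t
            * imhOp (Measure.count : Measure (Fin 3)) (fun _ => (1 : ℝ))
                (fun s => ((![1 / 20, 3 / 5, 7 / 20] : Fin 3 → ℝ) s
                  + (![1 / 20, 3 / 5, 7 / 20] : Fin 3 → ℝ) (Equiv.swap (0 : Fin 3) 2 s)) / 2)
                (![0, -1, 1] : Fin 3 → ℝ) t * (fun _ : Fin 3 => (1 : ℝ)) t ∂Measure.count
      < (∫ t, (![0, -1, 1] : Fin 3 → ℝ) t ^ 2 * (fun _ : Fin 3 => (1 : ℝ)) t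
            ∂(Measure.count : Measure (Fin 3)))
        - ∫ t, (![0, -1, 1] : Fin 3 → ℝ) t
            * imhOp (Measure.count : Measure (Fin 3)) (fun _ => (1 : ℝ)) (![1 / 20, 3 / 5, 7 / 20])
                (![0, -1, 1] : Fin 3 → ℝ) t * (fun _ : Fin 3 => (1 : ℝ)) t ∂Measure.count := by
  have h1 := iterate_qW_smul 1 1
  have h2 := iterate_qWs_smul 1 1
  simp only [Function.iterate_one] at h1 h2
  rw [sqNorm_gW]
  conv_lhs => rw [gW_eq_one_smul, h2]
  conv_rhs => rw [gW_eq_one_smul, h1]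
  rw [integral_count, integral_count]
  simp [Fin.sum_univ_three]
  norm_num

end MixedParityWitness

end Summit.Ventures.LatticeQCDFlow.Exactness
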